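import Mathlib.Analysis.SpecialFunctions.Gamma.Basic
import Mathlib.Analysis.SpecialFunctions.Pow.Deriv
import Literature.Barriers.FinalStateConjecture.GregoryLaflammeInstability
import Literature.Barriers.FinalStateConjecture.GregoryLaflammeSchrodinger

/-!
# Proof of Collingbourne's Proposition 4.5: the Gregory–Laflamme test function has negative energy

Topic `Literature/Barriers/FinalStateConjecture` (barrier catalogue `FinalStateConjecture`, D-0021;
namespace `Literature.Barriers.FinalStateConjecture`). This file DISCHARGES the named fact
`Literature.Barriers.FinalStateConjecture.GregoryLaflammeTestEnergyNegative`
(`GregoryLaflammeInstability.lean`; S. C. Collingbourne, J. Math. Phys. 62 (2021) 032502 =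
arXiv:2007.08441, Proposition 4.5 and its proof, §4.3, pp. 20–22): the theorem
`GregoryLaflammeTestEnergyNegative_holds`. Everything is proved; there is no `sorry`.

Recall the fact: for `3/10 ≤ |ω̂| ≤ 8/10` the test function
`u_T = x(1 + |ω̂|²x³)(x − 1)^{1/100} e^{−4|ω̂|(x−1)}` (`glTestFunction`, Prop. 4.5 with `n = 100`)
has finite `H¹(ℝ)`-norm in the tortoise variable (`HasFiniteGLH1Norm`), its energy density
`(|((x−1)/x) u_T'|² + V u_T²)·x/(x−1)` (`glEnergyDensity`, `V = glPotential`) is integrable on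
`(1, ∞)`, and `E(u_T) = ∫₁^∞ (…) dx < 0`.

## The argument (Collingbourne, §4.3, proof of Prop. 4.5)

Write `a = |ω̂|`, `t = x − 1 > 0` and, as in eq. (fk) of the source (with `n = 100`),
`f_k(x) = x^{k−1}(x−1)^{2/n−1}e^{−8a(x−1)}`. The source expands the energy integrand as
`Σ_{k=1}^{11} a_k f_{k−1}` with `a_1 = 0` and the kinetic part of the `H¹` integrand as
`Σ_{k=1}^{11} c_k f_{k−1}` with `c_1 = 1`, `|u_T|² x/(x−1) = f_4 + 2a²f_7 + a⁴f_10` (pp. 20–21),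
evaluates `I_k = ∫₁^∞ f_k = Γ(2/n) U(2/n, k + 2/n; 8a)` through the recurrences of the confluent
hypergeometric function `U` (for `k ≥ 1` these `U` are elementary), bounds `I_0 < ∞` directly
(estimate (I0)), and arrives at `E(u_T)/‖u_T‖²_{L²} = a² 𝔭(n,a)/𝔮(n,a)` with the integer
polynomials `p_i(n)`, `q_j(n)` printed on p. 22, concluding from `𝔭(100, 3/10) < 0`,
`𝔭(100, 8/10) < 0` and a Sturm-sequence root count. The formalisation follows this route,
organised so that only elementary integrals are ever evaluated:

* `hasDerivAt_glTestFunction`: for `x > 1`,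
  `u_T'(x) = D₁(x) (x−1)^{1/100 − 1} e^{−4a(x−1)}` with the polynomial
  `D₁ = glTestDerivPoly a x = (1 + 4a²x³)(x − 1) + x(1 + a²x³)(1/100 − 4a(x − 1))`.
* `glEnergyDensity_glTestFunction`, `glH1Density_glTestFunction`: the two integrands in closed
  form on `(1, ∞)`. Because `a_1 = 0`, the energy integrand is a combination of the ELEMENTARY
  basis functions `glBasis b c x = (x−1)^{c−1} e^{−b(x−1)}`, `b = 8a`, `c = 1/50 + k`,
  `k = 0, …, 9` (we expand in powers of `t = x − 1` instead of `x`: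
  `Σ_k a_{k+1} f_k = Σ_k d_k(a) t^k f_1`, the `d_k` being `glEnergyCoeff`); the `H¹` integrand is
  such a combination (`glH1Coeff`) plus the single non-elementary term `c_1 f_0 = f_1/x`, which is
  only shown integrable (`0 ≤ f_1/x ≤ f_1` on `(1, ∞)`; cf. estimate (I0) of the source). Both
  identities are `field_simp; ring` after the bookkeeping
  `(x−1)^{1/100} = (x−1)^{1/100−1}(x−1)`, `(x−1)^{1/50−1} = ((x−1)^{1/100−1})²(x−1)`,
  `e^{−8a(x−1)} = (e^{−4a(x−1)})²` (`gl_rpow_aux`, `gl_exp_aux`).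
* `integral_glBasis`: `∫₁^∞ (x−1)^{c−1} e^{−b(x−1)} dx = b^{−c} Γ(c)` for `b, c > 0` (translation
  `integral_Ioi_one_comp_sub_one` + Mathlib's `Real.integral_rpow_mul_exp_neg_mul_Ioi`), whence
  integrability (`integrableOn_glBasis`, `integrableOn_glBasis_div`), the first two conjuncts
  (`hasFiniteGLH1Norm_glTestFunction`, `integrableOn_glEnergyDensity_glTestFunction`) and, with
  `Γ(1/50 + k) = Γ(1/50) ∏_{j<k} (1/50 + j)` (`Gamma_add_nat_eq_prod_mul`),
  `E(u_T) = (8a)^{−1/50} Γ(1/50) · Σ_{k=0}^{9} d_k(a) (1/50)_k (8a)^{−k}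
         = (8a)^{−1/50} Γ(1/50) · Q(a) / (2¹⁸·10¹⁸·a³)`
  (`integral_glEnergyDensity_glTestFunction`, `glEnergySum_eq`), where `Q = glSignPolynomial` is
  an integer polynomial of degree `8`; coefficientwise
  `16·Q(a) = 𝔭(100, a) = Σ_{i=1}^9 p_i(100) a^{i−1}` with the `p_i(n)` of p. 22 (e.g.
  `16 · 655360000000000000000 = 1048576 · 100⁸ = p_9(100)`,
  `16 · 16790638709820737601 = 268650219357131801616 = p_1(100)`).
* `glSignPolynomial_neg`: `Q < 0` on `[3/10, 8/10]` (the real roots of `Q` in `(0, 1)` are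
  `≈ 0.28718` and `≈ 0.84655`; `Q(3/10) ≈ −2.39·10¹⁸`, `Q(8/10) ≈ −9.62·10¹⁹`), certified instead
  of Sturm's algorithm by the Bernstein expansion of `Q` on `[3/10, 8/10]`: all nine Bernstein
  coefficients are negative (between `−2.39·10¹⁸` and `−1.88·10²⁰`), i.e. `Q` is a combination
  of `(a − 3/10)^i (8/10 − a)^{8−i}`, `i = 0, …, 8`, with negative coefficients — `nlinarith`
  with these nine products as hints.

Sanity values (not used in the proofs): `E(u_T) ≈ −0.01638, −0.1085, −0.03414` and
`E(u_T)/‖u_T‖²_{L²} ≈ −2.56·10⁻⁴, −1.37·10⁻³, −2.59·10⁻⁴` at `a = 0.3, 0.5, 0.8`, in agreement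
with the closed form `a²𝔭/𝔮` of p. 21–22 and with "`E_0 ≤ E(u_T)/‖u_T‖² < −1/4000`" (p. 22).

## The quantitative form `E(u_T) < −(1/4000)‖u_T‖²_{L²(ℝ)}` (discharge of `GregoryLaflammeTestEnergyBound`)

The sibling `GregoryLaflammeSchrodinger.lean` records Proposition 4.5 in the quantitative form
printed at the end of its proof — "Hence, `E₀ ≤ E(u_T)/‖u_T‖²_{L²(ℝ)} < −1/4000 < 0` for all
`|ω̂| ∈ [3/10, 8/10]`" (p. 22) — as the named fact `GregoryLaflammeTestEnergyBound`, and proves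
`GregoryLaflammeInstability_of : GregoryLaflammeTestEnergyBound →
GregoryLaflammeNegativeEigenfunction → GregoryLaflammeInstability`. The last section of this
file DISCHARGES that fact too (`GregoryLaflammeTestEnergyBound_holds`), so that the barrier fact
`GregoryLaflammeInstability` now rests on the variational principle alone
(`GregoryLaflammeInstability_of_negativeEigenfunction`). In the source the constant `1/4000` is
not covered by the Sturm-sequence argument (which gives the sign of `𝔭` only); it is a separate
numerical fact about the printed rational function `|ω̂|²𝔭(n,|ω̂|)/𝔮(n,|ω̂|)` (p. 21), and it is
TIGHT at the left end of the band: `E(u_T)/‖u_T‖²_{L²} = −2.5596…·10⁻⁴` at `|ω̂| = 3/10` against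
`−1/4000 = −2.5·10⁻⁴` (margin `6.0·10⁻⁶`). Here:

* `glL2Density_glTestFunction`: `|u_T|² x/(x−1) = f_4 + 2|ω̂|²f_7 + |ω̂|⁴f_10` (p. 20), re-expanded
  as `Σ_{k=0}^{9} ℓ_k(a)(x−1)^k f_1` with `ℓ_k = C(3,k) + 2a²C(6,k) + a⁴C(9,k)` (`glL2Coeff`);
  `integral_glL2Density_glTestFunction`, `glL2Sum_eq`:
  `‖u_T‖²_{L²} = (8a)^{−1/50}Γ(1/50) · Ñ(a)/(2¹⁸·10¹⁸·a⁵)` with the integer polynomial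
  `Ñ = glL2Polynomial` of degree `9`; coefficientwise `16·Ñ(a) = 𝔮(100, a) = Σ_{j=1}^{10} q_j(100) a^{j−1}`
  with the `q_j(n)` of p. 22 — except that the recomputation gives the constant term of `q_1(n)` as
  `16` (as in `p_1(n)`), where the printed table reads `116`; the discrepancy (`100` out of
  `q_1(100) ≈ 2.66·10¹⁹`) is immaterial.
* `glBoundPolynomial_neg`: `4000a²Q(a) + Ñ(a) < 0` on `[3/10, 8/10]` — equivalently
  `4000|ω̂|²𝔭 + 𝔮 < 0`, i.e. `|ω̂|²𝔭/𝔮 < −1/4000` — certified by the Bernstein form of this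
  degree-`10` polynomial on the band: all eleven coefficients are negative (from `−2.0·10¹⁹`, the
  value at `3/10`, down to `−2.7·10²³`).
* `GregoryLaflammeTestEnergyBound_holds`: `E(u_T) + (1/4000)‖u_T‖²_{L²}
  = (8a)^{−1/50}Γ(1/50)(4000a²Q + Ñ)/(4000·2¹⁸·10¹⁸·a⁵) < 0`.

## References

* S. C. Collingbourne, *The Gregory–Laflamme instability of the Schwarzschild black string
  exterior*, J. Math. Phys. 62 (2021) 032502 = arXiv:2007.08441: Prop. 4.5 and its proof, §4.3,
  pp. 20–22 (eqs. (fk), (IK0), (IK), (I0); the tables `c_k`, `a_k` (p. 21) and `p_i(n)`, `q_j(n)`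
  (p. 22)). Key `Collingbourne2021`.
-/

noncomputable section

open MeasureTheory Set Filter Topology

namespace Literature.Barriers.FinalStateConjecture

/-! ### Elementary Gamma integrals on `(1, ∞)` -/

/-- The elementary basis functions `(x − 1)^{c−1} e^{−b(x−1)}` on `(1, ∞)`; for `b = 8|ω̂|`,
`c = 2/n + k` this is `(x−1)^k f_1(x)` in the notation
`f_k(x) = x^{k−1}(x−1)^{2/n−1}e^{−8|ω̂|(x−1)}` of Collingbourne, eq. (fk).
[cite: Collingbourne2021, §4.3 eq. (fk)] -/
def glBasis (b c x : ℝ) : ℝ := (x - 1) ^ (c - 1) * Real.exp (-(b * (x - 1)))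

/-- Translation `t = x − 1` of a ray integral: `∫₁^∞ g(x − 1) dx = ∫₀^∞ g(t) dt` (the change of
variables of eq. (IK) of the source; translation invariance of Lebesgue measure, no integrability
needed). [folklore] -/
theorem integral_Ioi_one_comp_sub_one (g : ℝ → ℝ) :
    ∫ x in Ioi (1 : ℝ), g (x - 1) = ∫ t in Ioi (0 : ℝ), g t := by
  rw [← integral_indicator measurableSet_Ioi, ← integral_indicator measurableSet_Ioi]
  have : (Ioi (1 : ℝ)).indicator (fun x ↦ g (x - 1)) =
      fun x ↦ (Ioi (0 : ℝ)).indicator g (x - 1) := by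
    funext x
    by_cases hx : x ∈ Ioi 1
    · rw [indicator_of_mem hx, indicator_of_mem (show x - 1 ∈ Ioi 0 by simpa using hx)]
    · rw [indicator_of_notMem hx, indicator_of_notMem (show x - 1 ∉ Ioi 0 by simpa using hx)]
  rw [this]
  exact integral_sub_right_eq_self _ (1 : ℝ)

/-- `∫₁^∞ (x−1)^{c−1} e^{−b(x−1)} dx = b^{−c} Γ(c)` for `b, c > 0` (Euler's integral,
Collingbourne eq. (IK) with (HG0)–(HG1): `I_1 = Γ(2/n)(8|ω̂|)^{−2/n}`). [folklore] -/
theorem integral_glBasis {b c : ℝ} (hb : 0 < b) (hc : 0 < c) :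
    ∫ x in Ioi (1 : ℝ), glBasis b c x = (1 / b) ^ c * Real.Gamma c := by
  unfold glBasis
  rw [integral_Ioi_one_comp_sub_one (fun t ↦ t ^ (c - 1) * Real.exp (-(b * t)))]
  exact Real.integral_rpow_mul_exp_neg_mul_Ioi hc hb

/-- The value `b^{−c} Γ(c)` is positive. [folklore] -/
theorem glBasis_integral_pos {b c : ℝ} (hb : 0 < b) (hc : 0 < c) :
    0 < (1 / b) ^ c * Real.Gamma c :=
  mul_pos (Real.rpow_pos_of_pos (by positivity) _) (Real.Gamma_pos_of_pos hc)

/-- The basis functions are integrable on `(1, ∞)` (their integral is a non-zero real number).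
[folklore] -/
theorem integrableOn_glBasis {b c : ℝ} (hb : 0 < b) (hc : 0 < c) :
    IntegrableOn (glBasis b c) (Ioi (1 : ℝ)) :=
  Integrable.of_integral_ne_zero (by
    rw [integral_glBasis hb hc]; exact (glBasis_integral_pos hb hc).ne')

/-- The basis functions are nonnegative on `(1, ∞)`. [folklore] -/
theorem glBasis_nonneg (b c : ℝ) {x : ℝ} (hx : 1 < x) : 0 ≤ glBasis b c x :=
  mul_nonneg (Real.rpow_nonneg (by linarith) _) (Real.exp_pos _).le

/-- The basis functions are measurable. [folklore] -/
theorem measurable_glBasis (b c : ℝ) : Measurable (glBasis b c) := by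
  unfold glBasis
  fun_prop

/-- The one non-elementary term of the `H¹` integrand, `c_1 f_0 = f_1/x`, is integrable on
`(1, ∞)`: `0 ≤ f_1/x ≤ f_1` there (cf. Collingbourne's estimate (I0), "`I_0 < ∞`").
[cite: Collingbourne2021, §4.3 eq. (I0)] -/
theorem integrableOn_glBasis_div {b c : ℝ} (hb : 0 < b) (hc : 0 < c) :
    IntegrableOn (fun x ↦ glBasis b c x / x) (Ioi (1 : ℝ)) := by
  refine Integrable.mono' (integrableOn_glBasis hb hc)
    ((measurable_glBasis b c).div measurable_id).aestronglyMeasurable ?_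
  filter_upwards [ae_restrict_mem measurableSet_Ioi] with x hx
  have h0 := glBasis_nonneg b c hx
  rw [Real.norm_eq_abs, abs_of_nonneg (div_nonneg h0 (by linarith [hx.out]))]
  exact div_le_self h0 hx.out.le

/-- `glBasis b (1/50 + k) x = (x−1)^{1/50−1} (x−1)^k e^{−b(x−1)}` for `x > 1` (`= (x−1)^k f_1`).
[folklore] -/
theorem glBasis_nat (b : ℝ) (k : ℕ) {x : ℝ} (hx : 1 < x) :
    glBasis b (1 / 50 + k) x =
      (x - 1) ^ ((1 : ℝ) / 50 - 1) * (x - 1) ^ k * Real.exp (-(b * (x - 1))) := by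
  unfold glBasis
  rw [show (1 : ℝ) / 50 + k - 1 = ((1 : ℝ) / 50 - 1) + k by ring,
    Real.rpow_add_natCast (by linarith)]

/-- `Γ(s + k) = (∏_{j<k} (s + j)) · Γ(s)` for `s > 0` (iterated functional equation; this is what
the recurrences (HG0)–(HG3) of the source amount to for the elementary integrals `I_k`, `k ≥ 1`).
[folklore] -/
theorem Gamma_add_nat_eq_prod_mul {s : ℝ} (hs : 0 < s) (k : ℕ) :
    Real.Gamma (s + k) = (∏ j ∈ Finset.range k, (s + j)) * Real.Gamma s := by
  induction k with
  | zero => simp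
  | succ k ih =>
    rw [Finset.prod_range_succ, Nat.cast_succ, ← add_assoc, Real.Gamma_add_one (by positivity), ih]
    ring

/-! ### The test function: derivative and the two integrands in closed form -/

/-- The polynomial factor `D₁(x) = (1 + 4a²x³)(x − 1) + x(1 + a²x³)(1/100 − 4a(x − 1))` of
`u_T' = D₁ (x−1)^{1/100−1} e^{−4a(x−1)}` (`a = |ω̂|`, `n = 100`). [folklore] -/
def glTestDerivPoly (a x : ℝ) : ℝ :=
  (1 + 4 * a ^ 2 * x ^ 3) * (x - 1) + x * (1 + a ^ 2 * x ^ 3) * (1 / 100 - 4 * a * (x - 1))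

/-- **The derivative of Collingbourne's test function** on `(1, ∞)`:
`u_T'(x) = D₁(x) (x−1)^{1/100−1} e^{−4|ω̂|(x−1)}`. [cite: Collingbourne2021, Prop. 4.5] -/
theorem hasDerivAt_glTestFunction (ω : ℝ) {x : ℝ} (hx : 1 < x) :
    HasDerivAt (glTestFunction ω)
      (glTestDerivPoly |ω| x * (x - 1) ^ ((1 : ℝ) / 100 - 1) *
        Real.exp (-4 * |ω| * (x - 1))) x := by
  have hne : x - 1 ≠ 0 := by linarith
  have hT : (x - 1) ^ ((1 : ℝ) / 100) = (x - 1) ^ ((1 : ℝ) / 100 - 1) * (x - 1) := by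
    rw [Real.rpow_sub_one hne, div_mul_cancel₀ _ hne]
  have h1 : HasDerivAt (fun y : ℝ ↦ y * (1 + |ω| ^ 2 * y ^ 3))
      (1 * (1 + |ω| ^ 2 * x ^ 3) + x * (|ω| ^ 2 * (↑(3 : ℕ) * x ^ (3 - 1) * 1))) x :=
    (hasDerivAt_id' (x := x)).fun_mul
      ((((hasDerivAt_id' (x := x)).fun_pow 3).const_mul (|ω| ^ 2)).const_add 1)
  have h2 : HasDerivAt (fun y : ℝ ↦ (y - 1) ^ ((1 : ℝ) / 100))
      (1 * ((1 : ℝ) / 100) * (x - 1) ^ ((1 : ℝ) / 100 - 1)) x :=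
    ((hasDerivAt_id' (x := x)).sub_const 1).rpow_const (p := (1 : ℝ) / 100) (Or.inl hne)
  have h3 : HasDerivAt (fun y : ℝ ↦ Real.exp (-4 * |ω| * (y - 1)))
      (Real.exp (-4 * |ω| * (x - 1)) * (-4 * |ω| * 1)) x :=
    (((hasDerivAt_id' (x := x)).sub_const 1).const_mul (-4 * |ω|)).exp
  refine ((h1.fun_mul h2).fun_mul h3).congr_deriv ?_
  rw [hT]
  simp only [glTestDerivPoly, Nat.cast_ofNat]
  ring

/-- The coefficients `d_k(a)`, `k = 0, …, 9`, of the energy integrand in the basis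
`(x−1)^k f_1`: `Σ_{k=1}^{11} a_k f_{k−1} = Σ_{k=0}^{9} d_k (x−1)^k f_1` (re-expansion of the table
`a_k`, `n = 100`, of Collingbourne p. 21 in powers of `x − 1`; `a_1 = 0` makes this possible).
[cite: Collingbourne2021, §4.3 p. 21] -/
def glEnergyCoeff (a : ℝ) : ℕ → ℝ
  | 0 => (a ^ 2 + 1) ^ 2 / 10000
  | 1 => (a ^ 2 + 1) * (10000 * a ^ 4 - 800 * a ^ 3 - 39193 * a ^ 2 - 800 * a + 10201) / 10000
  | 2 => a * (240000 * a ^ 5 - 325600 * a ^ 4 + 394821 * a ^ 3 - 406400 * a ^ 2 + 63012 * a -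
      80800) / 10000
  | 3 => a ^ 2 * (1400000 * a ^ 4 - 1936800 * a ^ 3 + 2092035 * a ^ 2 - 1209600 * a + 53008) /
      10000
  | 4 => a ^ 2 * (3920000 * a ^ 4 - 4828000 * a ^ 3 + 3836035 * a ^ 2 - 1206400 * a - 38998) /
      10000
  | 5 => a ^ 3 * (6300000 * a ^ 3 - 6428000 * a ^ 2 + 3342021 * a - 401600) / 10000
  | 6 => a ^ 4 * (6160000 * a ^ 2 - 4816800 * a + 1394807) / 10000
  | 7 => a ^ 4 * (3640000 * a ^ 2 - 1925600 * a + 220801) / 10000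
  | 8 => 2 * a ^ 5 * (1500 * a - 401) / 25
  | 9 => 17 * a ^ 6
  | _ => 0

/-- The coefficients `h_k(a)`, `k = 0, …, 9`, of the elementary part of the `H¹` integrand in the
basis `(x−1)^k f_1`:
`Σ_{k=2}^{11} c_k f_{k−1} + f_4 + 2a²f_7 + a⁴f_10 = Σ_{k=0}^{9} h_k (x−1)^k f_1` (re-expansion
of the table `c_k`, `n = 100`, of Collingbourne p. 21 and of
`|u_T|² x/(x−1) = f_4 + 2|ω̂|²f_7 + |ω̂|⁴f_10`, p. 20). [cite: Collingbourne2021, §4.3 pp. 20–21] -/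
def glH1Coeff (a : ℝ) : ℕ → ℝ
  | 0 => (10001 * a ^ 4 + 20002 * a ^ 2 + 1) / 10000
  | 1 => -(800 * a ^ 5 - 90807 * a ^ 4 + 1600 * a ^ 3 - 121008 * a ^ 2 + 800 * a - 40201) / 10000
  | 2 => (160000 * a ^ 6 - 325600 * a ^ 5 + 844821 * a ^ 4 - 406400 * a ^ 3 + 543012 * a ^ 2 -
      80800 * a + 30000) / 10000
  | 3 => (1120000 * a ^ 6 - 1936800 * a ^ 5 + 2932035 * a ^ 4 - 1209600 * a ^ 3 + 723008 * a ^ 2 +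
      10000) / 10000
  | 4 => a ^ 2 * (3360000 * a ^ 4 - 4828000 * a ^ 3 + 4796035 * a ^ 2 - 1206400 * a + 381002) /
      10000
  | 5 => a ^ 2 * (5600000 * a ^ 4 - 6428000 * a ^ 3 + 4152021 * a ^ 2 - 401600 * a + 120000) /
      10000
  | 6 => a ^ 2 * (5600000 * a ^ 4 - 4816800 * a ^ 3 + 1964807 * a ^ 2 + 20000) / 10000
  | 7 => a ^ 4 * (3360000 * a ^ 2 - 1925600 * a + 520801) / 10000
  | 8 => a ^ 4 * (2800 * a ^ 2 - 802 * a + 225) / 25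
  | 9 => a ^ 4 * (16 * a ^ 2 + 1)
  | _ => 0

/-- `rpow` bookkeeping at a point `x > 1`: `(x−1)^{1/100} = (x−1)^{1/100−1}(x−1)` and
`(x−1)^{1/50−1} = ((x−1)^{1/100−1})²(x−1)`. [folklore] -/
theorem gl_rpow_aux {x : ℝ} (hx : 1 < x) :
    (x - 1) ^ ((1 : ℝ) / 100) = (x - 1) ^ ((1 : ℝ) / 100 - 1) * (x - 1) ∧
      (x - 1) ^ ((1 : ℝ) / 50 - 1) = ((x - 1) ^ ((1 : ℝ) / 100 - 1)) ^ 2 * (x - 1) := by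
  have hne : x - 1 ≠ 0 := by linarith
  refine ⟨by rw [Real.rpow_sub_one hne, div_mul_cancel₀ _ hne], ?_⟩
  rw [← Real.rpow_natCast, ← Real.rpow_mul (by linarith), ← Real.rpow_add_one hne]
  norm_num

/-- `e^{−8a(x−1)} = (e^{−4a(x−1)})²`. [folklore] -/
theorem gl_exp_aux (a x : ℝ) :
    Real.exp (-(8 * a * (x - 1))) = Real.exp (-4 * a * (x - 1)) ^ 2 := by
  rw [sq, ← Real.exp_add]
  congr 1
  ring

/-- **The energy integrand in closed form** (Collingbourne p. 21, "The integrand can be written as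
`Σ_{k=1}^{11} a_k f_{k−1}`" with `a_1 = 0`, re-expanded in powers of `x − 1`): for `x > 1`,
`(|((x−1)/x) u_T'|² + V u_T²)·x/(x−1) = Σ_{k=0}^{9} d_k(|ω̂|) (x−1)^k f_1(x)`.
[cite: Collingbourne2021, §4.3 p. 21] -/
theorem glEnergyDensity_glTestFunction (ω : ℝ) {x : ℝ} (hx : 1 < x) :
    glEnergyDensity ω (glTestFunction ω) x =
      ∑ k ∈ Finset.range 10, glEnergyCoeff |ω| k * glBasis (8 * |ω|) (1 / 50 + k) x := by
  have hne : x - 1 ≠ 0 := by linarith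
  have hx0 : x ≠ 0 := by linarith
  have hG : 1 + |ω| ^ 2 * x ^ 3 ≠ 0 := by positivity
  obtain ⟨hT, hR⟩ := gl_rpow_aux hx
  rw [Finset.sum_congr rfl fun k _ ↦ by rw [glBasis_nat _ k hx]]
  simp only [Finset.sum_range_succ, Finset.sum_range_zero, glEnergyCoeff, glEnergyDensity]
  rw [(hasDerivAt_glTestFunction ω hx).deriv]
  simp only [glTestFunction, glTestDerivPoly, glPotential]
  rw [← sq_abs ω, hT, hR, gl_exp_aux]
  field_simp
  ring

/-- **The `H¹` integrand in closed form** (Collingbourne pp. 20–21: the kinetic part is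
`Σ_{k=1}^{11} c_k f_{k−1}` with `c_1 = 1`, and `|u_T|² x/(x−1) = f_4 + 2|ω̂|²f_7 + |ω̂|⁴f_10`),
re-expanded in powers of `x − 1`: for `x > 1`,
`(|((x−1)/x) u_T'|² + u_T²)·x/(x−1) = Σ_{k=0}^{9} h_k(|ω̂|) (x−1)^k f_1(x) + f_1(x)/x`.
[cite: Collingbourne2021, §4.3 pp. 20–21] -/
theorem glH1Density_glTestFunction (ω : ℝ) {x : ℝ} (hx : 1 < x) :
    glH1Density (glTestFunction ω) x =
      ∑ k ∈ Finset.range 10, glH1Coeff |ω| k * glBasis (8 * |ω|) (1 / 50 + k) x +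
        glBasis (8 * |ω|) (1 / 50) x / x := by
  have hne : x - 1 ≠ 0 := by linarith
  have hx0 : x ≠ 0 := by linarith
  obtain ⟨hT, hR⟩ := gl_rpow_aux hx
  rw [Finset.sum_congr rfl fun k _ ↦ by rw [glBasis_nat _ k hx]]
  simp only [Finset.sum_range_succ, Finset.sum_range_zero, glH1Coeff, glH1Density, glBasis]
  rw [(hasDerivAt_glTestFunction ω hx).deriv]
  simp only [glTestFunction, glTestDerivPoly]
  rw [hT, hR, gl_exp_aux]
  field_simp
  ring

/-! ### The algebraic certificate -/

/-- The sign-determining polynomial `Q(a) = 𝔭(100, a)/16`, where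
`𝔭(n, |ω̂|) = Σ_{i=1}^{9} p_i(n)|ω̂|^{i−1}` is Collingbourne's numerator polynomial (p. 22; e.g.
`p_9(100) = 1048576·100⁸ = 16 · 655360000000000000000` and
`p_1(100) = 268650219357131801616 = 16 · 16790638709820737601`). It arises here as
`Σ_{k=0}^{9} d_k(a) (1/50)_k (8a)^{−k} = Q(a)/(2¹⁸·10¹⁸·a³)` (`glEnergySum_eq`).
[cite: Collingbourne2021, §4.3 p. 22] -/
def glSignPolynomial (a : ℝ) : ℝ :=
  655360000000000000000 * a ^ 8 + 1979187200000000000000 * a ^ 7 -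
    1680064512000000000000 * a ^ 6 + 2282431037440000000000 * a ^ 5 -
    2205883185408000000000 * a ^ 4 - 22107611516416000000 * a ^ 3 -
    39874608448603520000 * a ^ 2 - 6404738739001276800 * a + 16790638709820737601

/-- **`𝔭(100, a) < 0` for `3/10 ≤ a ≤ 8/10`** (Collingbourne p. 22: "one can check, via Sturm's
algorithm, that the polynomial `𝔭(n, |ω̂|)` has two real roots in `|ω̂| ∈ (0, 1)`. Taking
`|ω̂| = 3/10` and `|ω̂| = 8/10`, one can check `𝔭(100, 3/10) < 0` and `𝔭(100, 8/10) < 0`"; the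
roots are `≈ 0.28718`, `≈ 0.84655`). Certified here by the Bernstein form of `Q` on
`[3/10, 8/10]`, all of whose nine coefficients are negative.
[cite: Collingbourne2021, §4.3 p. 22] -/
theorem glSignPolynomial_neg {a : ℝ} (h1 : 3 / 10 ≤ a) (h2 : a ≤ 8 / 10) :
    glSignPolynomial a < 0 := by
  have hp : 0 ≤ a - 3 / 10 := by linarith
  have hq : 0 ≤ 8 / 10 - a := by linarith
  unfold glSignPolynomial
  nlinarith [mul_nonneg (pow_nonneg hp 0) (pow_nonneg hq 8),
    mul_nonneg (pow_nonneg hp 1) (pow_nonneg hq 7), mul_nonneg (pow_nonneg hp 2) (pow_nonneg hq 6),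
    mul_nonneg (pow_nonneg hp 3) (pow_nonneg hq 5), mul_nonneg (pow_nonneg hp 4) (pow_nonneg hq 4),
    mul_nonneg (pow_nonneg hp 5) (pow_nonneg hq 3), mul_nonneg (pow_nonneg hp 6) (pow_nonneg hq 2),
    mul_nonneg (pow_nonneg hp 7) (pow_nonneg hq 1), mul_nonneg (pow_nonneg hp 8) (pow_nonneg hq 0)]

/-- The finite sum produced by the Gamma integrals is `Q(a)/(2¹⁸·10¹⁸·a³)`:
`Σ_{k=0}^{9} d_k(a) (8a)^{−k} ∏_{j<k}(1/50 + j) = glSignPolynomial a / (262144·10¹⁸·a³)`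
("complicated but purely algebraic calculations", Collingbourne p. 20).
[cite: Collingbourne2021, §4.3 pp. 21–22] -/
theorem glEnergySum_eq {a : ℝ} (ha : a ≠ 0) :
    ∑ k ∈ Finset.range 10, glEnergyCoeff a k * ((1 / (8 * a)) ^ k *
        ∏ j ∈ Finset.range k, ((1 : ℝ) / 50 + j)) =
      glSignPolynomial a / (262144 * 10 ^ 18 * a ^ 3) := by
  simp only [Finset.sum_range_succ, Finset.sum_range_zero, Finset.prod_range_succ,
    Finset.prod_range_zero, glEnergyCoeff, glSignPolynomial]
  push_cast
  field_simp
  ring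

/-! ### Assembly -/

/-- The energy integrand of `u_T` is integrable on `(1, ∞)` (`ω̂ ≠ 0`).
[cite: Collingbourne2021, Prop. 4.5] -/
theorem integrableOn_glEnergyDensity_glTestFunction {ω : ℝ} (hω : ω ≠ 0) :
    IntegrableOn (glEnergyDensity ω (glTestFunction ω)) (Ioi 1) := by
  have hb : 0 < 8 * |ω| := by positivity
  have h : IntegrableOn (fun x ↦ ∑ k ∈ Finset.range 10,
      glEnergyCoeff |ω| k * glBasis (8 * |ω|) (1 / 50 + k) x) (Ioi 1) :=
    integrable_finsetSum _ fun k _ ↦ (integrableOn_glBasis hb (by positivity)).const_mul _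
  exact h.congr_fun (fun x hx ↦ (glEnergyDensity_glTestFunction ω hx).symm) measurableSet_Ioi

/-- **`u_T ∈ H¹(ℝ)`** (Collingbourne, Prop. 4.5: "Then `u_T ∈ H¹(ℝ)`"; here for `n = 100` and
every `ω̂ ≠ 0`): the `H¹` density of `u_T` is integrable on `(1, ∞)`.
[cite: Collingbourne2021, Prop. 4.5] -/
theorem hasFiniteGLH1Norm_glTestFunction {ω : ℝ} (hω : ω ≠ 0) :
    HasFiniteGLH1Norm (glTestFunction ω) := by
  have hb : 0 < 8 * |ω| := by positivity
  have h : IntegrableOn (fun x ↦ ∑ k ∈ Finset.range 10,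
      glH1Coeff |ω| k * glBasis (8 * |ω|) (1 / 50 + k) x + glBasis (8 * |ω|) (1 / 50) x / x)
      (Ioi 1) :=
    (integrable_finsetSum _ fun k _ ↦ (integrableOn_glBasis hb (by positivity)).const_mul _).add
      (integrableOn_glBasis_div hb (by norm_num))
  exact h.congr_fun (fun x hx ↦ (glH1Density_glTestFunction ω hx).symm) measurableSet_Ioi

/-- **The energy of the test function in closed form**:
`E(u_T) = (8|ω̂|)^{−1/50} Γ(1/50) · Σ_{k=0}^{9} d_k(|ω̂|) (8|ω̂|)^{−k} ∏_{j<k} (1/50 + j)`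
(Collingbourne pp. 21–22: `E(u_T) = Σ a_k I_{k−1}`, `I_k = Γ(2/n)U(2/n, k+2/n; 8|ω̂|)`).
[cite: Collingbourne2021, §4.3 pp. 21–22] -/
theorem integral_glEnergyDensity_glTestFunction {ω : ℝ} (hω : ω ≠ 0) :
    ∫ x in Ioi 1, glEnergyDensity ω (glTestFunction ω) x =
      (1 / (8 * |ω|)) ^ ((1 : ℝ) / 50) * Real.Gamma (1 / 50) *
        ∑ k ∈ Finset.range 10, glEnergyCoeff |ω| k * ((1 / (8 * |ω|)) ^ k *
          ∏ j ∈ Finset.range k, ((1 : ℝ) / 50 + j)) := by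
  have hb : 0 < 8 * |ω| := by positivity
  rw [setIntegral_congr_fun measurableSet_Ioi (fun x hx ↦ glEnergyDensity_glTestFunction ω hx),
    integral_finsetSum _ (fun k _ ↦ (integrableOn_glBasis hb (by positivity)).const_mul _),
    Finset.mul_sum]
  refine Finset.sum_congr rfl fun k _ ↦ ?_
  rw [integral_const_mul, integral_glBasis hb (by positivity),
    Real.rpow_add_natCast (by positivity), Gamma_add_nat_eq_prod_mul (by norm_num)]
  ring

/-- **Collingbourne's Proposition 4.5, proved** — discharges the named fact
`GregoryLaflammeTestEnergyNegative`: for `3/10 ≤ |ω̂| ≤ 8/10` the test function `u_T`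
(`n = 100`) has finite `H¹(ℝ)`-norm, its energy density is integrable on `(1, ∞)`, and
`E(u_T) = (8|ω̂|)^{−1/50} Γ(1/50) · 𝔭(100, |ω̂|)/(16·2¹⁸·10¹⁸·|ω̂|³) < 0`.
[cite: Collingbourne2021, Prop. 4.5 and §4.3 pp. 20–22] -/
theorem GregoryLaflammeTestEnergyNegative_holds : GregoryLaflammeTestEnergyNegative := by
  intro ω h1 h2
  have hω : ω ≠ 0 := ne_zero_of_mem_glBand h1
  have ha : (0 : ℝ) < |ω| := abs_pos.2 hω
  refine ⟨hasFiniteGLH1Norm_glTestFunction hω, integrableOn_glEnergyDensity_glTestFunction hω, ?_⟩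
  rw [integral_glEnergyDensity_glTestFunction hω, glEnergySum_eq ha.ne']
  exact mul_neg_of_pos_of_neg
    (mul_pos (Real.rpow_pos_of_pos (by positivity) _) (Real.Gamma_pos_of_pos (by norm_num)))
    (div_neg_of_neg_of_pos (glSignPolynomial_neg h1 h2) (by positivity))

/-! ### The quantitative form: `E(u_T) < −(1/4000) ‖u_T‖²_{L²(ℝ)}` -/

/-- The coefficients `ℓ_k(a)`, `k = 0, …, 9`, of the `L²` density of the test function in the
basis `(x−1)^k f_1`: `|u_T|² x/(x−1) = f_4 + 2a²f_7 + a⁴f_10 = Σ_{k=0}^{9} ℓ_k (x−1)^k f_1`,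
`ℓ_k = C(3,k) + 2a²C(6,k) + a⁴C(9,k)` (binomial re-expansion of `x³(1 + a²x³)²` in powers of
`x − 1`; Collingbourne p. 20, the display `|u_T|² x/(x−1) = f_4 + 2|ω̂|²f_7 + |ω̂|⁴f_10`).
[cite: Collingbourne2021, §4.3 p. 20] -/
def glL2Coeff (a : ℝ) : ℕ → ℝ
  | 0 => 1 + 2 * a ^ 2 + a ^ 4
  | 1 => 3 + 12 * a ^ 2 + 9 * a ^ 4
  | 2 => 3 + 30 * a ^ 2 + 36 * a ^ 4
  | 3 => 1 + 40 * a ^ 2 + 84 * a ^ 4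
  | 4 => 30 * a ^ 2 + 126 * a ^ 4
  | 5 => 12 * a ^ 2 + 126 * a ^ 4
  | 6 => 2 * a ^ 2 + 84 * a ^ 4
  | 7 => 36 * a ^ 4
  | 8 => 9 * a ^ 4
  | 9 => a ^ 4
  | _ => 0

/-- **The `L²` density of the test function in closed form**: for `x > 1`,
`u_T(x)² · x/(x−1) = Σ_{k=0}^{9} ℓ_k(|ω̂|) (x−1)^k f_1(x)` (Collingbourne p. 20:
`|u_T|² x/(x−1) = f_4 + 2|ω̂|²f_7 + |ω̂|⁴f_10`). [cite: Collingbourne2021, §4.3 p. 20] -/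
theorem glL2Density_glTestFunction (ω : ℝ) {x : ℝ} (hx : 1 < x) :
    glTestFunction ω x ^ 2 * (x / (x - 1)) =
      ∑ k ∈ Finset.range 10, glL2Coeff |ω| k * glBasis (8 * |ω|) (1 / 50 + k) x := by
  have hne : x - 1 ≠ 0 := by linarith
  have hx0 : x ≠ 0 := by linarith
  obtain ⟨hT, hR⟩ := gl_rpow_aux hx
  rw [Finset.sum_congr rfl fun k _ ↦ by rw [glBasis_nat _ k hx]]
  simp only [Finset.sum_range_succ, Finset.sum_range_zero, glL2Coeff, glTestFunction]
  rw [hT, hR, gl_exp_aux]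
  field_simp
  ring

/-- The `L²` density of `u_T` is integrable on `(1, ∞)` (`ω̂ ≠ 0`; "`u_T ∈ H¹(ℝ)`", Prop. 4.5).
[cite: Collingbourne2021, Prop. 4.5] -/
theorem integrableOn_glL2Density_glTestFunction {ω : ℝ} (hω : ω ≠ 0) :
    IntegrableOn (fun x ↦ glTestFunction ω x ^ 2 * (x / (x - 1))) (Ioi 1) := by
  have hb : 0 < 8 * |ω| := by positivity
  have h : IntegrableOn (fun x ↦ ∑ k ∈ Finset.range 10,
      glL2Coeff |ω| k * glBasis (8 * |ω|) (1 / 50 + k) x) (Ioi 1) :=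
    integrable_finsetSum _ fun k _ ↦ (integrableOn_glBasis hb (by positivity)).const_mul _
  exact h.congr_fun (fun x hx ↦ (glL2Density_glTestFunction ω hx).symm) measurableSet_Ioi

/-- **`‖u_T‖²_{L²(ℝ)}` in closed form**:
`∫₁^∞ u_T² x/(x−1) dx = (8|ω̂|)^{−1/50} Γ(1/50) · Σ_{k=0}^{9} ℓ_k(|ω̂|) (8|ω̂|)^{−k} ∏_{j<k} (1/50 + j)`
(`= I_4 + 2|ω̂|²I_7 + |ω̂|⁴I_10` in the notation of eqs. (IK0)–(IK) of the source).
[cite: Collingbourne2021, §4.3 pp. 20–21] -/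
theorem integral_glL2Density_glTestFunction {ω : ℝ} (hω : ω ≠ 0) :
    ∫ x in Ioi 1, glTestFunction ω x ^ 2 * (x / (x - 1)) =
      (1 / (8 * |ω|)) ^ ((1 : ℝ) / 50) * Real.Gamma (1 / 50) *
        ∑ k ∈ Finset.range 10, glL2Coeff |ω| k * ((1 / (8 * |ω|)) ^ k *
          ∏ j ∈ Finset.range k, ((1 : ℝ) / 50 + j)) := by
  have hb : 0 < 8 * |ω| := by positivity
  rw [setIntegral_congr_fun measurableSet_Ioi (fun x hx ↦ glL2Density_glTestFunction ω hx),
    integral_finsetSum _ (fun k _ ↦ (integrableOn_glBasis hb (by positivity)).const_mul _),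
    Finset.mul_sum]
  refine Finset.sum_congr rfl fun k _ ↦ ?_
  rw [integral_const_mul, integral_glBasis hb (by positivity),
    Real.rpow_add_natCast (by positivity), Gamma_add_nat_eq_prod_mul (by norm_num)]
  ring

/-- The denominator polynomial `Ñ(a) = 𝔮(100, a)/16`, where
`𝔮(n, |ω̂|) = Σ_{j=1}^{10} q_j(n)|ω̂|^{j−1}` is Collingbourne's denominator polynomial (p. 22; e.g.
`q_10(100) = 4194304·100⁹ = 16 · 262144·10¹⁸`, `q_9(100) = 9437184·100⁸ = 16 · 5898240·10¹⁵`;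
the constant `16 · 1662479354624616801 = 26599669673993868816` is `q_1(100)` with constant term
`16` in `q_1(n)` — the printed `116` appears to be a misprint, immaterial at this size). It arises
here as `Σ_{k=0}^{9} ℓ_k(a) (1/50)_k (8a)^{−k} = Ñ(a)/(2¹⁸·10¹⁸·a⁵)` (`glL2Sum_eq`).
[cite: Collingbourne2021, §4.3 p. 22] -/
def glL2Polynomial (a : ℝ) : ℝ :=
  262144000000000000000000 * a ^ 9 + 5898240000000000000000 * a ^ 8 +
    527296102400000000000000 * a ^ 7 + 9636593664000000000000 * a ^ 6 +
    265654301962240000000000 * a ^ 5 + 3314303696025600000000 * a ^ 4 +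
    700574413637376000000 * a ^ 3 + 137159725633253760000 * a ^ 2 +
    19947828983531043600 * a + 1662479354624616801

/-- The finite sum produced by the Gamma integrals of the `L²` density is `Ñ(a)/(2¹⁸·10¹⁸·a⁵)`:
`Σ_{k=0}^{9} ℓ_k(a) (8a)^{−k} ∏_{j<k}(1/50 + j) = glL2Polynomial a / (262144·10¹⁸·a⁵)`.
[cite: Collingbourne2021, §4.3 pp. 21–22] -/
theorem glL2Sum_eq {a : ℝ} (ha : a ≠ 0) :
    ∑ k ∈ Finset.range 10, glL2Coeff a k * ((1 / (8 * a)) ^ k *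
        ∏ j ∈ Finset.range k, ((1 : ℝ) / 50 + j)) =
      glL2Polynomial a / (262144 * 10 ^ 18 * a ^ 5) := by
  simp only [Finset.sum_range_succ, Finset.sum_range_zero, Finset.prod_range_succ,
    Finset.prod_range_zero, glL2Coeff, glL2Polynomial]
  push_cast
  field_simp
  ring

/-- **`4000 a² Q(a) + Ñ(a) < 0` for `3/10 ≤ a ≤ 8/10`**, i.e. `4000|ω̂|²𝔭(100,|ω̂|) + 𝔮(100,|ω̂|) < 0`,
i.e. `|ω̂|²𝔭/𝔮 < −1/4000` (Collingbourne p. 22: "Hence, `E₀ ≤ E(u_T)/‖u_T‖²_{L²(ℝ)} < −1/4000`").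
The bound is tight at `a = 3/10` (ratio `−2.5596·10⁻⁴`). Certified by the Bernstein form of this
degree-`10` polynomial on `[3/10, 8/10]`: all eleven coefficients are negative (between
`−2.0·10¹⁹` and `−2.7·10²³`), i.e. it is a combination of `(a − 3/10)^i (8/10 − a)^{10−i}`,
`i = 0, …, 10`, with negative coefficients. [cite: Collingbourne2021, §4.3 p. 22] -/
theorem glBoundPolynomial_neg {a : ℝ} (h1 : 3 / 10 ≤ a) (h2 : a ≤ 8 / 10) :
    4000 * a ^ 2 * glSignPolynomial a + glL2Polynomial a < 0 := by
  have hp : 0 ≤ a - 3 / 10 := by linarith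
  have hq : 0 ≤ 8 / 10 - a := by linarith
  unfold glSignPolynomial glL2Polynomial
  nlinarith [mul_nonneg (pow_nonneg hp 0) (pow_nonneg hq 10),
    mul_nonneg (pow_nonneg hp 1) (pow_nonneg hq 9),
    mul_nonneg (pow_nonneg hp 2) (pow_nonneg hq 8),
    mul_nonneg (pow_nonneg hp 3) (pow_nonneg hq 7),
    mul_nonneg (pow_nonneg hp 4) (pow_nonneg hq 6),
    mul_nonneg (pow_nonneg hp 5) (pow_nonneg hq 5),
    mul_nonneg (pow_nonneg hp 6) (pow_nonneg hq 4),
    mul_nonneg (pow_nonneg hp 7) (pow_nonneg hq 3),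
    mul_nonneg (pow_nonneg hp 8) (pow_nonneg hq 2),
    mul_nonneg (pow_nonneg hp 9) (pow_nonneg hq 1),
    mul_nonneg (pow_nonneg hp 10) (pow_nonneg hq 0)]

/-- **Collingbourne's Proposition 4.5 in its quantitative form, proved** — discharges the named
fact `GregoryLaflammeTestEnergyBound` of `GregoryLaflammeSchrodinger.lean`: for
`3/10 ≤ |ω̂| ≤ 8/10`, `u_T` has finite `H¹(ℝ)`-norm, its energy density is integrable on `(1, ∞)`
and `E(u_T) < −(1/4000) ‖u_T‖²_{L²(ℝ)}`; indeed
`E(u_T) + (1/4000)‖u_T‖²_{L²} = (8|ω̂|)^{−1/50} Γ(1/50) (4000|ω̂|²Q + Ñ)(|ω̂|)/(4000·2¹⁸·10¹⁸·|ω̂|⁵) < 0`.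
[cite: Collingbourne2021, Prop. 4.5 and its proof, §4.3 pp. 20–22] -/
theorem GregoryLaflammeTestEnergyBound_holds : GregoryLaflammeTestEnergyBound := by
  intro ω h1 h2
  have hω : ω ≠ 0 := ne_zero_of_mem_glBand h1
  have ha : (0 : ℝ) < |ω| := abs_pos.2 hω
  have hane : |ω| ≠ 0 := ha.ne'
  refine ⟨hasFiniteGLH1Norm_glTestFunction hω, integrableOn_glEnergyDensity_glTestFunction hω, ?_⟩
  rw [integral_glEnergyDensity_glTestFunction hω, glEnergySum_eq hane,
    integral_glL2Density_glTestFunction hω, glL2Sum_eq hane]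
  have hC : 0 < (1 / (8 * |ω|)) ^ ((1 : ℝ) / 50) * Real.Gamma (1 / 50) :=
    mul_pos (Real.rpow_pos_of_pos (by positivity) _) (Real.Gamma_pos_of_pos (by norm_num))
  have hB := glBoundPolynomial_neg h1 h2
  set C := (1 / (8 * |ω|)) ^ ((1 : ℝ) / 50) * Real.Gamma (1 / 50) with hCdef
  have key : C * (glSignPolynomial |ω| / (262144 * 10 ^ 18 * |ω| ^ 3)) -
      -(1 / 4000) * (C * (glL2Polynomial |ω| / (262144 * 10 ^ 18 * |ω| ^ 5))) =
      C * (4000 * |ω| ^ 2 * glSignPolynomial |ω| + glL2Polynomial |ω|) /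
        (4000 * (262144 * 10 ^ 18 * |ω| ^ 5)) := by
    field_simp
    ring
  rw [← sub_neg, key]
  exact div_neg_of_neg_of_pos (mul_neg_of_pos_of_neg hC hB) (by positivity)

/-- **The barrier fact from the variational principle alone.** With both forms of Prop. 4.5
discharged, `GregoryLaflammeInstability` (Thm. 1.1 / Props. 4.1, 4.6 in reduced form) follows from
the single remaining named fact `GregoryLaflammeNegativeEigenfunction` (Prop. 4.3, Cor. 4.4,
Thm. 8.3) via `GregoryLaflammeInstability_of`. [cite: Collingbourne2021, proof of Prop. 4.6 (p. 22)] -/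
theorem GregoryLaflammeInstability_of_negativeEigenfunction
    (hB : GregoryLaflammeNegativeEigenfunction) : GregoryLaflammeInstability :=
  GregoryLaflammeInstability_of GregoryLaflammeTestEnergyBound_holds hB

end Literature.Barriers.FinalStateConjecture

end
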